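import Summits.ABC.ABC.Theorems.YuMatveevShapeRatCloses
import Summits.ABC.ABC.Theorems.IneffectiveSubspaceUniformSadicTowerFourThreeSlotQuasiPolynomial
import HarnessLib

/-!
# The three-prime cell of abc is quasi-polynomial — UNCONDITIONALLY (library effect of rung F-A1.L)

`Summits/ABC/ABC/Theorems/ThreeSlotQuasiPolynomialHolds.lean` — D-0145 ideator seat `abc-idea-3`
(generation 3, technique card «assume the opposite / build the counterexample until it breaks»),
2026-08-28.  SUPPORT / first-rung file for the crux `RigidThreeSlotABC` (stmt-ABC-23676, route
`ThreeSlotCyclotomicDescent`; also bears on `OmegaSplitFewPrime.ThreeSlotABC` = stmt-ABC-19048 and on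
rung `W = 3` of `UniformSadicTowerFour` = stmt-ABC-14937).

WHAT IS PROVED (sorry-free, NO hypotheses).  There is an absolute `K ≥ 1` such that every abc triple
`a + b = c` with `ω(abc) ≤ 3` satisfies
`log c ≤ (16 K⁴ / (log 2)²) · (∏_{p ∣ abc} log p) · log max(e, 2 log c)`
(`threeSlot_quasiPolynomial_holds`), hence, with an absolute `C > 0`,
`log c ≤ C · (1 + log rad(abc))³ · log max(e, 2 log c)` (`threeSlot_quasiPolynomial_rad_holds`):
abc is QUASI-POLYNOMIAL (`c ≤ exp((log rad)^{3+o(1)})`, ε-free, effective in shape) on the whole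
three-prime cell, balanced prime-power triples `{2^k, q^l, r^m}` included.

HOW.  The kernel argument is the tree's `threeSlot_quasiPolynomial` (strategist workfile of
stmt-ABC-14937, line `flat-steep-split`, 2026-08-17): parity forces `2 ∣ abc`, the even member of a
three-prime triple with `a, b ≥ 2` is a pure power `2^k`, and the 2-ADIC linear form has `v₂` equal
to the full exponent `k` while the `p / log p` loss of the `p`-adic estimate is the harmless constant
`2 / log 2` at `p = 2`; the archimedean form handles the rest.  Until 2026-08-27 that theorem was
available only modulo the named fact `Dioph.evertseGyory_thm_4_2_1_rat`
(`threeSlot_quasiPolynomial_of_evertseGyory`).  Its three hypotheses are `K`-parametric consequences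
of `PastenApproximationBound K` (`Pasten.arch_bound`, `Pasten.padic_bound_a`, `Pasten.padic_bound_c`
at threshold `0`, `theta_zero_eq`), and `∃ K ≥ 1, PastenApproximationBound K` is now the KERNEL
THEOREM `Summit.ABC.ABC.Theorems.approximationBound_rat_holds` (rung F-A1.L, route `YuMatveevShapeRat`,
✓ p584875).  This file performs the discharge: twenty lines, no new mathematics — the content is the
library effect (A1.L closed ⇒ the ω ≤ 3 wall is unconditional).

ASSUME-THE-OPPOSITE READING (why this seat files it).  A putative abc-violating sequence inside the
three-prime cell cannot be worse than quasi-polynomial: `log c / (log rad)^{3+o(1)}` stays bounded.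
So the counterexample «breaks» down to the gap between `(log rad)^{3+o(1)}` and `(1+ε)·log rad`,
which is exactly the product-of-logarithms wall of two- or three-logarithm linear forms (lift: Lang–Waldschmidt
for two logarithms, archimedean and 2-adic).  That gap — and nothing coarser — is what
`RigidThreeSlotABC` (stmt-ABC-23676) asks to close; this theorem is its first rung (T3/BC5 witness:
an ε-free analogue of the crux on the crux's own cell, where abc itself is not known).

WHAT THIS IS NOT.  Not abc on the cell (quality as large as `≍ (log rad)^{2+o(1)}` is still allowed);
not new mathematics relative to `threeSlot_quasiPolynomial` (same proof, hypotheses discharged); no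
summit / rung-A0 credit (FRONTIER-type statement).  typed ≠ proved elsewhere: `RigidThreeSlotABC`,
`ThreeSlotABC`, `UniformSadicTowerFour` stay OPEN.
-/

-- `Summit.<Summit>.<Problem>` is the mandated summit-side namespace (CONVENTIONS §2); for the
-- single-conjunct summit `ABC` the two coincide, so the duplicate `ABC.ABC` is deliberate.
set_option linter.dupNamespace false

namespace Summit.ABC.ABC.Theorems

open Literature.NumberTheory.DiophantineGeometry (IsABCTriple rad)
open Literature.NumberTheory.DiophantineGeometry.Pasten
  (arch_bound padic_bound_a padic_bound_c coprime_right_of_isABCTriple)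
open Literature.Barriers.ABC (theta_zero_eq)
open Finset Real

/-- **Quasi-polynomial abc on the three-prime cell, unconditionally**: there is `K ≥ 1` such that every
abc triple with `ω(abc) ≤ 3` has `log c ≤ (16K⁴/(log 2)²) · (∏_{p ∣ abc} log p) · log max(e, 2 log c)`.
The tree's `threeSlot_quasiPolynomial` with its three linear-forms hypotheses discharged by the kernel
theorem `approximationBound_rat_holds` (rung F-A1.L). [folklore] assembly
[cite: Pasten2024, Theorem 2.1 (d = 1)] [cite: StewartYu2001, Theorem 1 (method)] -/
theorem threeSlot_quasiPolynomial_holds :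
    ∃ K : ℝ, 1 ≤ K ∧ ∀ a b c : ℕ, IsABCTriple a b c → (a * b * c).primeFactors.card ≤ 3 →
      Real.log c ≤ (16 * K ^ 4 / Real.log 2 ^ 2) * (∏ p ∈ (a * b * c).primeFactors, Real.log p) *
        Real.log (max (Real.exp 1) (2 * Real.log c)) := by
  obtain ⟨K, hK, hP⟩ := approximationBound_rat_holds
  refine ⟨K, hK, UniformSadicTowerFour.ThreeSlotWall.threeSlot_quasiPolynomial K hK ?_ ?_ ?_⟩
  · intro a b c h
    have hc : c ≠ 0 := by obtain ⟨ha, -, habc, -⟩ := h; omega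
    have := arch_bound hK hP h 0
    rwa [theta_zero_eq K h.2.1.ne' hc (coprime_right_of_isABCTriple h)] at this
  · intro a b c h p hp hpa
    have hc : c ≠ 0 := by obtain ⟨ha, -, habc, -⟩ := h; omega
    have := padic_bound_a hK hP h 0 hp hpa
    rwa [theta_zero_eq K h.2.1.ne' hc (coprime_right_of_isABCTriple h)] at this
  · intro a b c h h1 p hp hpc
    have := padic_bound_c hK hP h h1 0 hp hpc
    rwa [theta_zero_eq K h.1.ne' h.2.1.ne' h.2.2.2] at this

/-- On a set of at most three primes all dividing `rad(abc)`, `∏ log p ≤ (1 + log rad(abc))³`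
(each factor lies in `[0, 1 + log rad]` and `1 ≤ 1 + log rad`). [folklore] -/
theorem prod_log_primeFactors_le_cube {a b c : ℕ} (h3 : (a * b * c).primeFactors.card ≤ 3) :
    ∏ p ∈ (a * b * c).primeFactors, Real.log p ≤ (1 + Real.log (rad a b c : ℕ)) ^ 3 := by
  have hrad1 : (1 : ℝ) ≤ (rad a b c : ℕ) := by
    exact_mod_cast Nat.succ_le_of_lt
      (by rw [Literature.NumberTheory.DiophantineGeometry.rad_def]; exact Nat.radical_pos _)
  have hL0 : 0 ≤ Real.log (rad a b c : ℕ) := Real.log_nonneg hrad1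
  have hfac : ∀ p ∈ (a * b * c).primeFactors, Real.log p ≤ 1 + Real.log (rad a b c : ℕ) := by
    intro p hp
    have hp' : p ∈ (rad a b c).primeFactors := by
      rw [Literature.NumberTheory.DiophantineGeometry.rad_def, Nat.primeFactors_radical]; exact hp
    have hle : p ≤ rad a b c := Nat.le_of_mem_primeFactors hp'
    have hp0 : 0 < p := (Nat.prime_of_mem_primeFactors hp).pos
    have : Real.log p ≤ Real.log (rad a b c : ℕ) :=
      Real.log_le_log (by exact_mod_cast hp0) (by exact_mod_cast hle)
    linarith
  have hnonneg : ∀ p ∈ (a * b * c).primeFactors, 0 ≤ Real.log p := fun p hp =>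
    Real.log_nonneg (by exact_mod_cast (Nat.prime_of_mem_primeFactors hp).one_lt.le)
  calc ∏ p ∈ (a * b * c).primeFactors, Real.log p
      ≤ ∏ _p ∈ (a * b * c).primeFactors, (1 + Real.log (rad a b c : ℕ)) :=
        Finset.prod_le_prod hnonneg hfac
    _ = (1 + Real.log (rad a b c : ℕ)) ^ (a * b * c).primeFactors.card := by
        rw [Finset.prod_const]
    _ ≤ (1 + Real.log (rad a b c : ℕ)) ^ 3 :=
        pow_le_pow_right₀ (by linarith) h3

/-- **Radical form**: an absolute `C > 0` with `log c ≤ C · (1 + log rad(abc))³ · log max(e, 2 log c)` for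
every abc triple with `ω(abc) ≤ 3` — i.e. `c ≤ exp((log rad)^{3+o(1)})` on the three-prime cell,
unconditionally. [folklore] corollary of `threeSlot_quasiPolynomial_holds`
[cite: Pasten2024, Theorem 2.1 (d = 1)] -/
theorem threeSlot_quasiPolynomial_rad_holds :
    ∃ C : ℝ, 0 < C ∧ ∀ a b c : ℕ, IsABCTriple a b c → (a * b * c).primeFactors.card ≤ 3 →
      Real.log c ≤ C * (1 + Real.log (rad a b c : ℕ)) ^ 3 *
        Real.log (max (Real.exp 1) (2 * Real.log c)) := by
  obtain ⟨K, hK, hmain⟩ := threeSlot_quasiPolynomial_holds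
  have hl2 : 0 < Real.log 2 := Real.log_pos one_lt_two
  have hC : 0 < 16 * K ^ 4 / Real.log 2 ^ 2 := by positivity
  refine ⟨16 * K ^ 4 / Real.log 2 ^ 2, hC, fun a b c h h3 => ?_⟩
  have hY : 0 ≤ Real.log (max (Real.exp 1) (2 * Real.log c)) :=
    Real.log_nonneg (le_trans (by have := Real.add_one_le_exp (1 : ℝ); linarith) (le_max_left _ _))
  calc Real.log c
      ≤ (16 * K ^ 4 / Real.log 2 ^ 2) * (∏ p ∈ (a * b * c).primeFactors, Real.log p) *
          Real.log (max (Real.exp 1) (2 * Real.log c)) := hmain a b c h h3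
    _ ≤ (16 * K ^ 4 / Real.log 2 ^ 2) * (1 + Real.log (rad a b c : ℕ)) ^ 3 *
          Real.log (max (Real.exp 1) (2 * Real.log c)) := by
        apply mul_le_mul_of_nonneg_right _ hY
        exact mul_le_mul_of_nonneg_left (prod_log_primeFactors_le_cube h3) hC.le

end Summit.ABC.ABC.Theorems
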